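import Mathlib
import HarnessLib
import Summits.QuantumFields.Statement
import Literature.MathematicalPhysics.QuantumFieldTheory.Balaban1983to89.T3InteriorExcision
import Literature.MathematicalPhysics.QuantumFieldTheory.Balaban1983to89.T3YM3TorusStatement
import Summits.QuantumFields.YangMills.Theses.ReplicaVarianceTilt

/-! # BC3 birth skeleton for crux `HeightChiSqL` of route `ReplicaVarianceTilt` (D-0145 seat ym-r3-idea-1 g3, lens «control»).
Post-birth form: imports the route module and concludes the route decl `ReplicaVarianceTilt.HeightChiSqL` BY NAME.
Two registered stubs + the kernel-checked composition `HeightChiSqL_of`.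
* `stub_acIntegrable` (M): SUPPORT/REGULARITY at fixed K — for every block size, profile and free top fraction, at small γ, the run-(K+1)
  descended restricted density is a.e. dominated by the run-K one and the chi-square integrand (ρ¹)²/ρ⁰ is integrable (both vanish off
  the height-⌊K/m⌋ window PlaqSmall θ(⌊K/m⌋) and are positive inside it via strictly-small lifts: Bałaban's variational problem Thm 1,
  [Balaban1985Variational]; the window edge is null). No uniformity in K is asked.
* `stub_ratioBound` (XL, the heart): the QUANTITATIVE replica bound — thresholds, m, γ₁ and a summable-√ sequence v with, for every K,
  integrability ⇒ (∫(ρ¹)²/ρ⁰)(∫ρ⁰) ≤ (1+v_K)(∫ρ¹)²; proof plan = glued two-replica pressure Φ_K(s,s'), log of the ratio = ∫∫∂s∂s'Φ_K =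
  cross-replica truncated correlation of the top defect D_K, bounded by one cluster expansion of the doubled interpolated system
  [King1986 Thm 2.1/3.4 engine; Balaban1988Convergent] or by Brascamp–Lieb under hierarchical convexity [BrascampLieb1976].
Honours the seat censuses: B-1 (second order, no linear term), B-4 (mixed derivative only). -/

namespace Summit.QuantumFields.YangMills.Cruxes.HeightChiSqL.ReplicaBirth

open Summit.QuantumFields.YangMills.Theses.ReplicaVarianceTilt (HeightChiSqL)

open scoped BigOperators Topology Classical MeasureTheory ProbabilityTheory Matrix
open Filter Set Function TopologicalSpace MeasureTheory
open Literature.MathematicalPhysics.QuantumFieldTheory.Balaban1983to89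
open Literature.MathematicalPhysics.QuantumFieldTheory.Balaban1983to89.T3ContinuumYM3Torus
open Literature.MathematicalPhysics.QuantumFieldTheory.Balaban1983to89.T3UnitScaleTilt
open Literature.MathematicalPhysics.QuantumFieldTheory.Balaban1983to89.T3TiltDescent
open Literature.MathematicalPhysics.QuantumFieldTheory.Balaban1983to89.T3UnitLawDensityEML (ℰp)

/-- stub (M): a.c. and integrability of the chi-square integrand at every fixed K, for every profile and every free top fraction.
[cite: Balaban1985Variational, Thm 1] -/
theorem stub_acIntegrable : ∀ (L : ℕ) (b₀ p₀ : ℝ), 0 < b₀ → 2 < p₀ → ∀ (m : ℕ), 0 < m → ∃ γ₁ : ℝ, 0 < γ₁ ∧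
    ∀ (F : T3Family) (γ : ℝ), F.L = L → 0 < γ → γ ≤ γ₁ → ∀ K : ℕ,
      (∀ᵐ V ∂fieldMeasure (F.P (K / m)) 0 (Matrix.specialUnitaryGroup (Fin 2) ℂ), heightDensity F γ (Nat.div_le_self K m) (histGood F ℰp (θBal F.L γ b₀ p₀) K (K / m)) V = 0 → heightDensity F γ ((Nat.div_le_self K m).trans (Nat.le_succ K)) (histGood F ℰp (θBal F.L γ b₀ p₀) (K + 1) (K / m)) V = 0) ∧
      Integrable (fun V => heightDensity F γ ((Nat.div_le_self K m).trans (Nat.le_succ K)) (histGood F ℰp (θBal F.L γ b₀ p₀) (K + 1) (K / m)) V ^ 2 / heightDensity F γ (Nat.div_le_self K m) (histGood F ℰp (θBal F.L γ b₀ p₀) K (K / m)) V) (fieldMeasure (F.P (K / m)) 0 (Matrix.specialUnitaryGroup (Fin 2) ℂ)) := by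
  sorry

/-- stub (XL, load-bearing): the quantitative replica bound given integrability. [cite: King1986, Thm 3.4; Balaban1988Convergent] -/
theorem stub_ratioBound : ∀ (L : ℕ), ∃ (b₁ p₁ : ℝ), ∀ (b₀ p₀ : ℝ), b₁ ≤ b₀ → p₁ ≤ p₀ → 0 < b₀ → 2 < p₀ →
    ∃ m : ℕ, 0 < m ∧ ∃ γ₁ : ℝ, 0 < γ₁ ∧ ∀ (F : T3Family) (γ : ℝ), F.L = L → 0 < γ → γ ≤ γ₁ →
      ∃ v : ℕ → ℝ, Summable (fun K => Real.sqrt (v K)) ∧ (∀ K, 0 ≤ v K) ∧ ∀ K : ℕ,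
        Integrable (fun V => heightDensity F γ ((Nat.div_le_self K m).trans (Nat.le_succ K)) (histGood F ℰp (θBal F.L γ b₀ p₀) (K + 1) (K / m)) V ^ 2 / heightDensity F γ (Nat.div_le_self K m) (histGood F ℰp (θBal F.L γ b₀ p₀) K (K / m)) V) (fieldMeasure (F.P (K / m)) 0 (Matrix.specialUnitaryGroup (Fin 2) ℂ)) →
        (∫ V, heightDensity F γ ((Nat.div_le_self K m).trans (Nat.le_succ K)) (histGood F ℰp (θBal F.L γ b₀ p₀) (K + 1) (K / m)) V ^ 2 / heightDensity F γ (Nat.div_le_self K m) (histGood F ℰp (θBal F.L γ b₀ p₀) K (K / m)) V ∂fieldMeasure (F.P (K / m)) 0 (Matrix.specialUnitaryGroup (Fin 2) ℂ)) * (∫ V, heightDensity F γ (Nat.div_le_self K m) (histGood F ℰp (θBal F.L γ b₀ p₀) K (K / m)) V ∂fieldMeasure (F.P (K / m)) 0 (Matrix.specialUnitaryGroup (Fin 2) ℂ)) ≤ (1 + v K) * (∫ V, heightDensity F γ ((Nat.div_le_self K m).trans (Nat.le_succ K)) (histGood F ℰp (θBal F.L γ b₀ p₀) (K + 1) (K /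 m)) V ∂fieldMeasure (F.P (K / m)) 0 (Matrix.specialUnitaryGroup (Fin 2) ℂ)) ^ 2 := by
  sorry

/-- COMPOSITION (kernel-checked, no sorry of its own): the two stubs, BY NAME, give the crux BY NAME. -/
theorem HeightChiSqL_of : Summit.QuantumFields.YangMills.Theses.ReplicaVarianceTilt.HeightChiSqL := by
  intro L
  obtain ⟨b₁, p₁, hB'⟩ := stub_ratioBound L
  refine ⟨b₁, p₁, fun b₀ p₀ hb hp hb₀ hp₀ => ?_⟩
  obtain ⟨m, hm, γB, hγB, hB''⟩ := hB' b₀ p₀ hb hp hb₀ hp₀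
  obtain ⟨γA, hγA, hA'⟩ := stub_acIntegrable L b₀ p₀ hb₀ hp₀ m hm
  refine ⟨m, hm, min γA γB, lt_min hγA hγB, fun F γ hL hγ hγ₁ => ?_⟩
  obtain ⟨v, hv, hv0, hK⟩ := hB'' F γ hL hγ (hγ₁.trans (min_le_right _ _))
  refine ⟨v, hv, hv0, fun K => ?_⟩
  obtain ⟨hac, hint⟩ := hA' F γ hL hγ (hγ₁.trans (min_le_left _ _)) K
  exact ⟨hac, hint, hK K hint⟩

end Summit.QuantumFields.YangMills.Cruxes.HeightChiSqL.ReplicaBirth
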